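import Literature.Geometry.Lorentzian.KerrData
import Literature.Geometry.Lorentzian.OpensCausality
import Literature.Geometry.Lorentzian.SchwarzschildKerrSchildComponents
import HarnessLib

/-!
# Crux `SwallowTheDatum.UniversalWitnessFamily` (stmt-FinalStateConjecture-10051), line `Sketch`
# (throat-settles-too), stub `stub_sheetCauchy` — part 1: time functions of the Schwarzschild
# exterior along timelike curves

Helper file for the stub `stub_sheetCauchy` (the static slice `{t = 0}` is a Cauchy hypersurface
of the Schwarzschild exterior `Kerr.region 0 (Kerr.rPlus M 0) = {r > 2M}` with the Kerr–Schild
metric `Kerr.smoothMetric M 0 (2M) = η + (2M/r) ℓ ⊗ ℓ`, `ℓ = (1, x⃗/r)`, time-oriented by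
`V = −g♯dt*`).  Along a future timelike curve `γ` of the exterior:

* `hasDerivAt_of_isFutureTimelikeCurveOn`, `minkowski_isFutureTimelikeCurveOn` — the chart curve
  `val ∘ γ` is differentiable with `g`-timelike velocity `v`, `v⁰ > 0`; since
  `g − η = (2M/r) ℓ ⊗ ℓ ≥ 0` the cones of `g` are narrower than those of `η`, so `γ` is a future
  timelike curve of Minkowski space `(E4, η, ∂ₜ)`;
* `cone_ineq`, `hasDerivAt_pos` — the retarded time `u = t* − r − 4M log(r/2M − 1)` and the
  advanced time `v = t* + r` have positive derivative along `γ` (`du`, `dv` are null covectors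
  positive on the future cone);
* `strictMonoOn_retardedTime`, `strictMonoOn_advancedTime`,
  `strictMonoOn_continuousOn_staticTime` — `u`, `v` and static time `t = (u + v)/2 =
  t* − 2M log(r/2M − 1)` are strictly increasing along `γ` (mean value theorem).

References: R. M. Wald, *General Relativity* (1984), §6.4, (6.4.21)–(6.4.23); B. O'Neill,
*Semi-Riemannian geometry* (1983), Ch. 5, p. 145, Ch. 14, Def. 14.28; M. Dafermos,
I. Rodnianski, arXiv:0811.0354, §5.1.
-/

set_option linter.dupNamespace false

noncomputable section

open scoped Manifold ContDiff Topology InnerProductSpace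
open Set Function Filter Literature.Geometry.Lorentzian

namespace Summit.FinalStateConjecture.FinalStateConjecture.Theorems.SwallowTheDatum.UniversalWitnessFamily

namespace SheetCauchy

/-! ## Conventions

Throughout, for a chart point `x : E4` of the exterior (`r = E4.spatialNorm x = ‖x⃗‖ > 2M`):
static time `t = x 0 - 2M log(r/2M − 1)`, retarded time `u = x 0 − r − 4M log(r/2M − 1)`,
advanced time `v = x 0 + r` (Wald 1984, §6.4, (6.4.21)–(6.4.23)); `2t = u + v`.  They are written
out in full (no auxiliary definitions). -/

/-- Membership in the Schwarzschild exterior chart domain is `2M < ‖x⃗‖` (`r₊ = 2M`, `r = ‖x⃗‖`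
for `a = 0`). Dafermos–Rodnianski arXiv:0811.0354, §5.1. -/
theorem mem_region_iff {M : ℝ} (hM : 0 ≤ M) {x : E4} :
    x ∈ Kerr.region 0 (Kerr.rPlus M 0) ↔ 2 * M < E4.spatialNorm x := by
  rw [Kerr.mem_region, Kerr.radius_zero_left, Kerr.rPlus_zero_right hM,
    max_eq_left (by linarith)]

/-! ## The cone inequality of the Schwarzschild–Kerr–Schild metric -/

/-- **The cone inequality.** If `−a² + S + (2M/r)(a + b)² < 0` with `b² ≤ S`, `a > 0`, `r > 2M ≥ 0`
(the values `a = v⁰`, `b = ⟪x⃗, v⃗⟫/r`, `S = ‖v⃗‖²` of a future `g_{M,0}`-timelike vector `v` at a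
point with `‖x⃗‖ = r`), then `−a < b` and `b (r + 2M) < a (r − 2M)`; the second inequality says
`du(v) > 0` for the retarded time `u`. O'Neill 1983, Ch. 5, p. 145; Wald 1984, §6.4. -/
theorem cone_ineq {M r a b S : ℝ} (hM : 0 ≤ M) (hr : 2 * M < r) (ha : 0 < a) (hb : b ^ 2 ≤ S)
    (hg : -(a * a) + S + 2 * M / r * ((a + b) * (a + b)) < 0) :
    -a < b ∧ b * (r + 2 * M) < a * (r - 2 * M) := by
  have hr0 : 0 < r := by linarith
  have hnn : 0 ≤ 2 * M / r * ((a + b) * (a + b)) :=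
    mul_nonneg (by positivity) (mul_self_nonneg _)
  have hS : b ^ 2 < a ^ 2 := by nlinarith
  obtain ⟨hab, -⟩ := abs_lt_of_sq_lt_sq' hS ha.le
  refine ⟨hab, ?_⟩
  have hpos : 0 < a + b := by linarith
  have h2 : (a + b) * ((b - a) * r + 2 * M * (a + b)) < 0 := by
    have : (a + b) * ((b - a) * r + 2 * M * (a + b)) =
        r * (-(a * a) + b ^ 2 + 2 * M / r * ((a + b) * (a + b))) := by
      field_simp
      ring
    rw [this]
    exact mul_neg_of_pos_of_neg hr0 (by nlinarith)
  have h3 : (b - a) * r + 2 * M * (a + b) < 0 := by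
    by_contra h
    exact absurd h2 (not_lt.mpr (mul_nonneg hpos.le (not_lt.mp h)))
  linarith

/-! ## Future timelike curves of the Kerr–Schild exterior -/

/-- Along a future timelike curve `γ` of the Schwarzschild exterior `(Kerr.region 0 2M, g_{M,0},
−g♯dt*)`, at a parameter of its domain: the chart curve `c = val ∘ γ` has a derivative `v`, with
`v⁰ > 0` (`g(V, v) = −v⁰ < 0`) and `g_{M,0}(v, v) < 0`. O'Neill 1983, Ch. 5, p. 145;
Dafermos–Rodnianski arXiv:0811.0354, §5.1. -/
theorem hasDerivAt_of_isFutureTimelikeCurveOn {M : ℝ} [Kerr.Facts] (hM : 0 < M)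
    {γ : ℝ → Kerr.region 0 (Kerr.rPlus M 0)} {s : Set ℝ}
    (hγ : (Kerr.smoothMetric M 0 (Kerr.rPlus M 0)).IsFutureTimelikeCurveOn
      ((Kerr.timeOrientation M 0 (Kerr.rPlus M 0) hM.le).ofLE le_top) γ s) {σ : ℝ} (hσ : σ ∈ s) :
    HasDerivAt (Subtype.val ∘ γ) (deriv (Subtype.val ∘ γ) σ) σ ∧
      0 < deriv (Subtype.val ∘ γ) σ 0 ∧
      Kerr.bilin M 0 (γ σ : E4) (deriv (Subtype.val ∘ γ) σ) (deriv (Subtype.val ∘ γ) σ) < 0 := by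
  obtain ⟨hd, htl, hfd⟩ := hγ σ hσ
  have hdc : MDifferentiableAt 𝓘(ℝ, ℝ) 𝓘(ℝ, E4) (Subtype.val ∘ γ) σ :=
    (mdifferentiableAt_subtypeVal_comp_curve_iff (I := 𝓘(ℝ, E4))
      (Kerr.region 0 (Kerr.rPlus M 0))).2 hd
  have hd' : DifferentiableAt ℝ (Subtype.val ∘ γ) σ := mdifferentiableAt_iff_differentiableAt.mp hdc
  have hv : (velocity 𝓘(ℝ, E4) γ σ : E4) = deriv (Subtype.val ∘ γ) σ := by
    rw [← velocity_subtypeVal_comp (I := 𝓘(ℝ, E4)) (Kerr.region 0 (Kerr.rPlus M 0)) γ σ]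
    change mfderiv 𝓘(ℝ, ℝ) 𝓘(ℝ, E4) (Subtype.val ∘ γ) σ 1 = deriv (Subtype.val ∘ γ) σ
    rw [mfderiv_eq_fderiv]
    rfl
  have hx : 0 < Kerr.radius 0 (γ σ : E4) := Kerr.radius_pos_of_mem_region (γ σ).2
  refine ⟨hd'.hasDerivAt, ?_, ?_⟩
  · have h := hfd.2
    change Kerr.bilin M 0 (γ σ : E4) (Kerr.timeVector M 0 (γ σ : E4)) (velocity 𝓘(ℝ, E4) γ σ) < 0
      at h
    rw [Kerr.bilin_timeVector hx, hv] at h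
    linarith
  · have h := htl
    change Kerr.bilin M 0 (γ σ : E4) (velocity 𝓘(ℝ, E4) γ σ) (velocity 𝓘(ℝ, E4) γ σ) < 0 at h
    rwa [hv] at h

/-- **The cones of `g_{M,0}` are narrower than those of `η`**: a future timelike curve of the
Schwarzschild exterior in ingoing Kerr–Schild coordinates is a future timelike curve of Minkowski
space `(E4, η, ∂ₜ)` (`g(v, v) = η(v, v) + (2M/r) ℓ(v)² ≥ η(v, v)`, and `g(V, v) = η(∂ₜ, v) = −v⁰`).
Dafermos–Rodnianski arXiv:0811.0354, §5.1; O'Neill 1983, Ch. 5, p. 145. -/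
theorem minkowski_isFutureTimelikeCurveOn {M : ℝ} [Kerr.Facts] (hM : 0 < M)
    {γ : ℝ → Kerr.region 0 (Kerr.rPlus M 0)} {s : Set ℝ}
    (hγ : (Kerr.smoothMetric M 0 (Kerr.rPlus M 0)).IsFutureTimelikeCurveOn
      ((Kerr.timeOrientation M 0 (Kerr.rPlus M 0) hM.le).ofLE le_top) γ s) :
    Minkowski.spacetime.metric.IsFutureTimelikeCurveOn Minkowski.spacetime.timeOrientation
      (Subtype.val ∘ γ) s := by
  intro σ hσ
  obtain ⟨hd, htl, hfd⟩ := hγ σ hσ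
  have hdc : MDifferentiableAt 𝓘(ℝ, ℝ) 𝓘(ℝ, E4) (Subtype.val ∘ γ) σ :=
    (mdifferentiableAt_subtypeVal_comp_curve_iff (I := 𝓘(ℝ, E4))
      (Kerr.region 0 (Kerr.rPlus M 0))).2 hd
  have hv := velocity_subtypeVal_comp (I := 𝓘(ℝ, E4)) (Kerr.region 0 (Kerr.rPlus M 0)) γ σ
  have hx : 0 < Kerr.radius 0 (γ σ : E4) := Kerr.radius_pos_of_mem_region (γ σ).2
  set v : E4 := velocity 𝓘(ℝ, E4) γ σ with hvdef
  have htl' : Kerr.bilin M 0 (γ σ : E4) v v < 0 := htl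
  have hfd' : Kerr.bilin M 0 (γ σ : E4) (Kerr.timeVector M 0 (γ σ : E4)) v < 0 := hfd.2
  rw [Kerr.bilin_timeVector hx] at hfd'
  have hη : Minkowski.bilin v v < 0 := by
    rw [Kerr.bilin_apply] at htl'
    have hH := Kerr.scalarH_nonneg hM.le 0 (γ σ : E4)
    nlinarith [mul_self_nonneg (Kerr.nullCovector 0 (γ σ : E4) v)]
  have hv0 : v ≠ 0 := by
    intro h
    rw [h] at hfd'
    simp at hfd'
  refine ⟨hdc, ?_, ⟨?_, ?_⟩, ?_⟩
  · change Minkowski.bilin (velocity 𝓘(ℝ, E4) (Subtype.val ∘ γ) σ)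
      (velocity 𝓘(ℝ, E4) (Subtype.val ∘ γ) σ) < 0
    rw [hv]
    exact hη
  · change Minkowski.bilin (velocity 𝓘(ℝ, E4) (Subtype.val ∘ γ) σ)
      (velocity 𝓘(ℝ, E4) (Subtype.val ∘ γ) σ) ≤ 0
    rw [hv]
    exact hη.le
  · change (velocity 𝓘(ℝ, E4) (Subtype.val ∘ γ) σ : E4) ≠ 0
    rw [hv]
    exact hv0
  · change Minkowski.bilin (E4.basisVector 0) (velocity 𝓘(ℝ, E4) (Subtype.val ∘ γ) σ) < 0
    rw [hv, Minkowski.bilin_basisVector_zero_left]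
    linarith


/-! ## Derivatives of `r`, `u`, `v` along a chart curve -/

/-- Derivative of the spatial radius `r = ‖x⃗‖` along a differentiable chart curve off the time
axis: `(r ∘ c)' = ⟪x⃗, v⃗⟫ / r`. [folklore] -/
theorem hasDerivAt_spatialNorm_comp {c : ℝ → E4} {v : E4} {σ : ℝ} (hc : HasDerivAt c v σ)
    (hx : 0 < E4.spatialNorm (c σ)) :
    HasDerivAt (fun σ ↦ E4.spatialNorm (c σ))
      (⟪E4.spatial (c σ), E4.spatial v⟫_ℝ / E4.spatialNorm (c σ)) σ := by
  have h1 : HasDerivAt (fun σ ↦ E4.spatial (c σ)) (E4.spatial v) σ :=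
    E4.spatial.hasFDerivAt.comp_hasDerivAt σ hc
  have hx' : 0 < ‖E4.spatial (c σ)‖ := hx
  have hne : ‖E4.spatial (c σ)‖ ^ 2 ≠ 0 := by positivity
  have h3 := h1.norm_sq.sqrt hne
  have heq : (fun σ ↦ E4.spatialNorm (c σ)) = fun σ ↦ √(‖E4.spatial (c σ)‖ ^ 2) := by
    funext σ
    rw [Real.sqrt_sq (norm_nonneg _)]
    rfl
  rw [heq]
  convert h3 using 1
  rw [Real.sqrt_sq (norm_nonneg _)]
  change _ / ‖E4.spatial (c σ)‖ = _
  field_simp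

/-- Derivative of `log(r/2M − 1)` along a chart curve in `{r > 2M}`: `⟪x⃗, v⃗⟫ / (r (r − 2M))`.
[folklore] -/
theorem hasDerivAt_log_comp {M : ℝ} (hM : 0 < M) {c : ℝ → E4} {v : E4} {σ : ℝ}
    (hc : HasDerivAt c v σ) (hx : 2 * M < E4.spatialNorm (c σ)) :
    HasDerivAt (fun σ ↦ Real.log (E4.spatialNorm (c σ) / (2 * M) - 1))
      (⟪E4.spatial (c σ), E4.spatial v⟫_ℝ /
        (E4.spatialNorm (c σ) * (E4.spatialNorm (c σ) - 2 * M))) σ := by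
  have hr : 0 < E4.spatialNorm (c σ) := by linarith
  have h2M : (0 : ℝ) < 2 * M := by linarith
  have hne : E4.spatialNorm (c σ) / (2 * M) - 1 ≠ 0 := by
    have : 1 < E4.spatialNorm (c σ) / (2 * M) := by
      rw [lt_div_iff₀ h2M]
      linarith
    linarith
  have hne' : E4.spatialNorm (c σ) - 2 * M ≠ 0 := by linarith
  have h := (((hasDerivAt_spatialNorm_comp hc hr).div_const (2 * M)).sub_const 1).log hne
  convert h using 1
  field_simp

/-- Derivative of the advanced time `v = t* + r` along a chart curve: `v⁰ + ⟪x⃗, v⃗⟫ / r`.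
Wald 1984, §6.4. -/
theorem hasDerivAt_advancedTime_comp {c : ℝ → E4} {v : E4} {σ : ℝ} (hc : HasDerivAt c v σ)
    (hx : 0 < E4.spatialNorm (c σ)) :
    HasDerivAt (fun σ ↦ c σ 0 + E4.spatialNorm (c σ))
      (v 0 + ⟪E4.spatial (c σ), E4.spatial v⟫_ℝ / E4.spatialNorm (c σ)) σ := by
  have h0 : HasDerivAt (fun σ ↦ c σ 0) (v 0) σ := by
    have := ((EuclideanSpace.proj (0 : Fin 4) : E4 →L[ℝ] ℝ).hasFDerivAt.comp_hasDerivAt σ hc)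
    simpa [Function.comp_def] using this
  exact h0.add (hasDerivAt_spatialNorm_comp hc hx)

/-- Derivative of the retarded time `u = t* − r − 4M log(r/2M − 1)` along a chart curve in
`{r > 2M}`: `v⁰ − ⟪x⃗, v⃗⟫/r − 4M ⟪x⃗, v⃗⟫ / (r (r − 2M))`. Wald 1984, §6.4. -/
theorem hasDerivAt_retardedTime_comp {M : ℝ} (hM : 0 < M) {c : ℝ → E4} {v : E4} {σ : ℝ}
    (hc : HasDerivAt c v σ) (hx : 2 * M < E4.spatialNorm (c σ)) :
    HasDerivAt
      (fun σ ↦ c σ 0 - E4.spatialNorm (c σ) - 4 * M * Real.log (E4.spatialNorm (c σ) / (2 * M) - 1))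
      (v 0 - ⟪E4.spatial (c σ), E4.spatial v⟫_ℝ / E4.spatialNorm (c σ) -
        4 * M * (⟪E4.spatial (c σ), E4.spatial v⟫_ℝ /
          (E4.spatialNorm (c σ) * (E4.spatialNorm (c σ) - 2 * M)))) σ := by
  have hr : 0 < E4.spatialNorm (c σ) := by linarith
  have h0 : HasDerivAt (fun σ ↦ c σ 0) (v 0) σ := by
    have := ((EuclideanSpace.proj (0 : Fin 4) : E4 →L[ℝ] ℝ).hasFDerivAt.comp_hasDerivAt σ hc)
    simpa [Function.comp_def] using this
  exact (h0.sub (hasDerivAt_spatialNorm_comp hc hr)).sub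
    ((hasDerivAt_log_comp hM hc hx).const_mul (4 * M))

/-- **The retarded and advanced times increase strictly along future timelike curves of the
Schwarzschild exterior**: at every parameter of the domain `u ∘ γ` and `v ∘ γ` have positive
derivative (`du`, `dv` are positive on the future cone of `g_{M,0}` in `{r > 2M}`; `cone_ineq`).
Wald 1984, §6.4; O'Neill 1983, Ch. 5, p. 145. -/
theorem hasDerivAt_pos {M : ℝ} [Kerr.Facts] (hM : 0 < M)
    {γ : ℝ → Kerr.region 0 (Kerr.rPlus M 0)} {s : Set ℝ}
    (hγ : (Kerr.smoothMetric M 0 (Kerr.rPlus M 0)).IsFutureTimelikeCurveOn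
      ((Kerr.timeOrientation M 0 (Kerr.rPlus M 0) hM.le).ofLE le_top) γ s) {σ : ℝ} (hσ : σ ∈ s) :
    ∃ du dv : ℝ,
      HasDerivAt (fun σ ↦ (Subtype.val ∘ γ) σ 0 - E4.spatialNorm ((Subtype.val ∘ γ) σ) -
        4 * M * Real.log (E4.spatialNorm ((Subtype.val ∘ γ) σ) / (2 * M) - 1)) du σ ∧ 0 < du ∧
      HasDerivAt (fun σ ↦ (Subtype.val ∘ γ) σ 0 + E4.spatialNorm ((Subtype.val ∘ γ) σ)) dv σ ∧
        0 < dv := by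
  obtain ⟨hc, h0, hg⟩ := hasDerivAt_of_isFutureTimelikeCurveOn hM hγ hσ
  have hx : 2 * M < E4.spatialNorm ((Subtype.val ∘ γ) σ) := (mem_region_iff hM.le).1 (γ σ).2
  have hr : 0 < E4.spatialNorm ((Subtype.val ∘ γ) σ) := by linarith
  change Kerr.bilin M 0 ((Subtype.val ∘ γ) σ) _ _ < 0 at hg
  rw [Kerr.bilin_zero_spin_apply M hr.ne'] at hg
  have hU := hasDerivAt_retardedTime_comp hM hc hx
  have hV := hasDerivAt_advancedTime_comp hc hr
  rw [div_mul_eq_div_div] at hU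
  set v : E4 := deriv (Subtype.val ∘ γ) σ with hv
  set r : ℝ := E4.spatialNorm ((Subtype.val ∘ γ) σ) with hr_def
  set b : ℝ := ⟪E4.spatial ((Subtype.val ∘ γ) σ), E4.spatial v⟫_ℝ / r with hb
  have hb2 : b ^ 2 ≤ ⟪E4.spatial v, E4.spatial v⟫_ℝ := by
    rw [real_inner_self_eq_norm_sq]
    have habs : |b| ≤ ‖E4.spatial v‖ := by
      rw [hb, abs_div, abs_of_pos hr, div_le_iff₀ hr]
      calc |⟪E4.spatial ((Subtype.val ∘ γ) σ), E4.spatial v⟫_ℝ|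
          ≤ ‖E4.spatial ((Subtype.val ∘ γ) σ)‖ * ‖E4.spatial v‖ := abs_real_inner_le_norm _ _
        _ = ‖E4.spatial v‖ * r := by rw [mul_comm, hr_def]; rfl
    exact sq_le_sq' (abs_le.mp habs).1 (abs_le.mp habs).2
  obtain ⟨hab, hkey⟩ := cone_ineq hM.le hx h0 hb2 hg
  have hr2 : 0 < r - 2 * M := by linarith
  refine ⟨_, _, hU, ?_, hV, by linarith⟩
  have hr2' : r - 2 * M ≠ 0 := hr2.ne'
  have h1 : b * (r + 2 * M) / (r - 2 * M) < v 0 := (div_lt_iff₀ hr2).2 hkey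
  have h2 : (b + 4 * M * (b / (r - 2 * M))) * (r - 2 * M) = b * (r + 2 * M) := by
    have h3 : b / (r - 2 * M) * (r - 2 * M) = b := div_mul_cancel₀ b hr2'
    calc (b + 4 * M * (b / (r - 2 * M))) * (r - 2 * M)
        = b * (r - 2 * M) + 4 * M * (b / (r - 2 * M) * (r - 2 * M)) := by ring
      _ = b * (r + 2 * M) := by rw [h3]; ring
  have h4 : b + 4 * M * (b / (r - 2 * M)) = b * (r + 2 * M) / (r - 2 * M) :=
    (eq_div_iff hr2').2 h2
  show 0 < v 0 - b - 4 * M * (b / (r - 2 * M))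
  linarith

/-- A real function with a positive derivative at every point of an interval is strictly
increasing there (mean value theorem). [folklore] -/
theorem strictMonoOn_of_hasDerivAt_pos {f : ℝ → ℝ} {s : Set ℝ} (hs : s.OrdConnected)
    (hf : ∀ σ ∈ s, ∃ d, HasDerivAt f d σ ∧ 0 < d) : StrictMonoOn f s := by
  refine strictMonoOn_of_deriv_pos hs.convex (fun σ hσ ↦ ?_) (fun σ hσ ↦ ?_)
  · obtain ⟨d, hd, -⟩ := hf σ hσ
    exact hd.continuousAt.continuousWithinAt
  · obtain ⟨d, hd, hpos⟩ := hf σ (interior_subset hσ)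
    rwa [hd.deriv]

/-- Retarded time is strictly increasing along a future timelike curve of the Schwarzschild
exterior defined on an interval. Wald 1984, §6.4. -/
theorem strictMonoOn_retardedTime {M : ℝ} [Kerr.Facts] (hM : 0 < M)
    {γ : ℝ → Kerr.region 0 (Kerr.rPlus M 0)} {s : Set ℝ} (hs : s.OrdConnected)
    (hγ : (Kerr.smoothMetric M 0 (Kerr.rPlus M 0)).IsFutureTimelikeCurveOn
      ((Kerr.timeOrientation M 0 (Kerr.rPlus M 0) hM.le).ofLE le_top) γ s) :
    StrictMonoOn (fun σ ↦ (Subtype.val ∘ γ) σ 0 - E4.spatialNorm ((Subtype.val ∘ γ) σ) -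
      4 * M * Real.log (E4.spatialNorm ((Subtype.val ∘ γ) σ) / (2 * M) - 1)) s :=
  strictMonoOn_of_hasDerivAt_pos hs fun σ hσ ↦ by
    obtain ⟨du, dv, hu, hu0, -, -⟩ := hasDerivAt_pos hM hγ hσ
    exact ⟨du, hu, hu0⟩

/-- Advanced time is strictly increasing along a future timelike curve of the Schwarzschild
exterior defined on an interval. Wald 1984, §6.4. -/
theorem strictMonoOn_advancedTime {M : ℝ} [Kerr.Facts] (hM : 0 < M)
    {γ : ℝ → Kerr.region 0 (Kerr.rPlus M 0)} {s : Set ℝ} (hs : s.OrdConnected)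
    (hγ : (Kerr.smoothMetric M 0 (Kerr.rPlus M 0)).IsFutureTimelikeCurveOn
      ((Kerr.timeOrientation M 0 (Kerr.rPlus M 0) hM.le).ofLE le_top) γ s) :
    StrictMonoOn (fun σ ↦ (Subtype.val ∘ γ) σ 0 + E4.spatialNorm ((Subtype.val ∘ γ) σ)) s :=
  strictMonoOn_of_hasDerivAt_pos hs fun σ hσ ↦ by
    obtain ⟨du, dv, -, -, hv, hv0⟩ := hasDerivAt_pos hM hγ hσ
    exact ⟨dv, hv, hv0⟩

/-- **Static time is a time function of the Schwarzschild exterior**: `t = (u + v)/2` is strictly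
increasing and continuous along every future timelike curve defined on an interval (at most one
crossing of each level set `{t = c}`). Wald 1984, §6.4; O'Neill 1983, Ch. 14, Def. 14.28. -/
theorem strictMonoOn_continuousOn_staticTime {M : ℝ} [Kerr.Facts] (hM : 0 < M)
    {γ : ℝ → Kerr.region 0 (Kerr.rPlus M 0)} {s : Set ℝ} (hs : s.OrdConnected)
    (hγ : (Kerr.smoothMetric M 0 (Kerr.rPlus M 0)).IsFutureTimelikeCurveOn
      ((Kerr.timeOrientation M 0 (Kerr.rPlus M 0) hM.le).ofLE le_top) γ s) :
    StrictMonoOn (fun σ ↦ (Subtype.val ∘ γ) σ 0 -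
        2 * M * Real.log (E4.spatialNorm ((Subtype.val ∘ γ) σ) / (2 * M) - 1)) s ∧
      ContinuousOn (fun σ ↦ (Subtype.val ∘ γ) σ 0 -
        2 * M * Real.log (E4.spatialNorm ((Subtype.val ∘ γ) σ) / (2 * M) - 1)) s := by
  have heq : (fun σ ↦ (Subtype.val ∘ γ) σ 0 -
      2 * M * Real.log (E4.spatialNorm ((Subtype.val ∘ γ) σ) / (2 * M) - 1)) =
      fun σ ↦ (((Subtype.val ∘ γ) σ 0 - E4.spatialNorm ((Subtype.val ∘ γ) σ) -
        4 * M * Real.log (E4.spatialNorm ((Subtype.val ∘ γ) σ) / (2 * M) - 1)) +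
        ((Subtype.val ∘ γ) σ 0 + E4.spatialNorm ((Subtype.val ∘ γ) σ))) / 2 := by
    funext σ
    ring
  have hd : ∀ σ ∈ s, ∃ d, HasDerivAt (fun σ ↦ (Subtype.val ∘ γ) σ 0 -
      2 * M * Real.log (E4.spatialNorm ((Subtype.val ∘ γ) σ) / (2 * M) - 1)) d σ ∧ 0 < d := by
    intro σ hσ
    obtain ⟨du, dv, hu, hu0, hv, hv0⟩ := hasDerivAt_pos hM hγ hσ
    refine ⟨(du + dv) / 2, ?_, by positivity⟩
    rw [heq]
    exact (hu.add hv).div_const 2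
  exact ⟨strictMonoOn_of_hasDerivAt_pos hs hd, fun σ hσ ↦ by
    obtain ⟨d, hd, -⟩ := hd σ hσ
    exact hd.continuousAt.continuousWithinAt⟩

end SheetCauchy

/-! ## The registered sub-goal of this part: at most one crossing -/

open SheetCauchy in
/-- **Sub-goal `stub_sheetCauchy_monotone` of stub `stub_sheetCauchy` (line `Sketch`): static
time is a time function of the Kerr–Schild Schwarzschild exterior.**  For `M > 0`, along every
future timelike curve `γ` of `(Kerr.region 0 2M, g_{M,0}, −g♯dt*)` defined on an interval `s`,
static time `t = t* − 2M log(r/2M − 1)` (evaluated on the chart curve `val ∘ γ`) is strictly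
increasing and continuous on `s`; in particular `γ` meets each level set `{t = c}` — e.g. the
static slice `{t = 0}` — at most once.  (Closed form of `strictMonoOn_continuousOn_staticTime`,
registered on the crux item as the sub-goal served by this helper file.)  Wald 1984, §6.4;
O'Neill 1983, Ch. 14, Def. 14.28. -/
theorem stub_sheetCauchy_monotone :
  ∀ [Kerr.Facts] (M : ℝ) (hM : 0 < M) (γ : ℝ → Kerr.region 0 (Kerr.rPlus M 0)) (s : Set ℝ),
    s.OrdConnected →
    (Kerr.smoothMetric M 0 (Kerr.rPlus M 0)).IsFutureTimelikeCurveOn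
      ((Kerr.timeOrientation M 0 (Kerr.rPlus M 0) hM.le).ofLE le_top) γ s →
    StrictMonoOn (fun σ ↦ (Subtype.val ∘ γ) σ 0 -
        2 * M * Real.log (E4.spatialNorm ((Subtype.val ∘ γ) σ) / (2 * M) - 1)) s ∧
      ContinuousOn (fun σ ↦ (Subtype.val ∘ γ) σ 0 -
        2 * M * Real.log (E4.spatialNorm ((Subtype.val ∘ γ) σ) / (2 * M) - 1)) s :=
  fun _ hM _ _ hs hγ ↦ strictMonoOn_continuousOn_staticTime hM hs hγ

end Summit.FinalStateConjecture.FinalStateConjecture.Theorems.SwallowTheDatum.UniversalWitnessFamily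

end
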